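import Literature.NumberTheory.LFunctions.KloostermanLFunction
import HarnessLib

/-!
# The `L`-function of a hybrid character sum `∑ χ(f(x)) ψ(bx)` is a polynomial (Schmidt, Ch. II §9)

Topic `Literature/NumberTheory/LFunctions` (exponential sums), grouping namespace `HybridLFunction`.
W. M. Schmidt, *Equations over Finite Fields. An Elementary Approach*, LNM 536 (1976), Ch. II,
§8 ("`L`-functions of character sums": for a function `X` on monic polynomials with
`X(h₁h₂) = X(h₁)X(h₂)` the series `L(U) = Σ_h X(h) U^{deg h}` has the Euler product of Theorem 8B,
whence `U L'/L = Σ_ν S_ν U^ν` with `S_ν = Σ_{P, j : j deg P = ν} deg P · X(P)^j`) and §9 (for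
`X(h) = χ({f/h}) ψ([g/h])`, `{f/h} = Π_{h(β)=0} f(β)`, `[g/h] = Σ_{h(β)=0} g(β)`, the coefficients
`c_n = Σ_{deg h = n} X(h)` vanish for large `n`, so `L` is a polynomial). We PROVE, for an
arbitrary finite field `F`:

* §1 (generic) `IsMonicMul Λ` (complete multiplicativity on monic polynomials), `lsumOf Λ n = c_n`,
  `psumOf Λ i = S_i`, and **the von Mangoldt identity** `mul_lsumOf_eq_sum`:
  `n c_n = Σ_{i=1}^n S_i c_{n−i}` — the finite content of Theorem 8B, by unique factorisation in
  `F[X]` (the Kloosterman special case is `KloostermanLFunction.mul_lsum_eq_sum_psum_mul_lsum`,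
  whose bookkeeping `monics`, `irrMonicsLE`, `sum_primePowers_dvd_eq_natDegree` we reuse);
* §2 the hybrid function of a SPLIT polynomial `f = c Π_{i<ℓ} (X − r_i)` and the additive twist
  `x ↦ bx`: `lam χ ψ c r b h = χ(c^{deg h} (−1)^{ℓ deg h} Π_i h(r_i)) · ψ(−b · nextCoeff h)` (for
  monic `h = Π (X − β_j)` this is `χ(Π_j f(β_j)) ψ(b Σ_j β_j)`, Schmidt's `χ({f/h}) ψ([g/h])` with
  `g = bX`), `isMonicMul_lam`;
* §3 **`lsumOf_lam_eq_zero`**: if `χ ≠ 1`, `ℓ ≥ 1` and the `r_i` are distinct, then `c_n = 0` for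
  every `n ≥ ℓ + 1` (write `h = QV + ρ`, `V = Π (X − r_i)`, `deg ρ < ℓ`; then `h(r_i) = ρ(r_i)`,
  `nextCoeff h = nextCoeff Q + nextCoeff V`, and `ρ ↦ (ρ(r_i))_i` is a bijection onto `F^ℓ`, so the
  `ρ`-sum factors as `Π_i Σ_{v ∈ F} χ(v) = 0`) — i.e. `L(U) = 1 + c_1 U + ⋯ + c_ℓ U^ℓ`
  (Schmidt's Lemma 9B-type vanishing, here for split `f`, which is the case needed for products of
  linear factors). [cite: Schmidt1976, Ch. II §8 Theorems 8A–8B, §9]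

This is the first of four files establishing the elementary (Stepanov–Schmidt) Weil bound
`|Σ_{x ∈ F} χ(f(x)) ψ(bx)| ≤ ℓ √q` for the quadratic character and split square-free `f`, the
input (3.13) of Tao–Teräväinen's Lemma 3.7 (`Literature.Barriers.Parity.TaoTeravainen2021_lemma37_k0`).

## References

* W. M. Schmidt, *Equations over Finite Fields. An Elementary Approach*, Lecture Notes in
  Math. 536, Springer (1976), Ch. II §8 (Theorems 8A, 8B), §9 (Lemmas 9A–9C, Theorem 2G').
* A. Weil, *On some exponential sums*, Proc. Nat. Acad. Sci. USA 34 (1948) 204–207.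
-/

noncomputable section

open Finset Polynomial

namespace Literature.NumberTheory.LFunctions

open KloostermanLFunction (monics mem_monics sum_monics irrMonicsLE mem_irrMonicsLE
  one_le_natDegree_of_irreducible sum_primePowers_dvd_eq_natDegree)

namespace HybridLFunction

/-! ### §1. Completely multiplicative functions on monic polynomials and their `L`-coefficients -/

section Generic

variable {F : Type*} [Field F]

/-- `Λ` is completely multiplicative on monic polynomials: `Λ(1) = 1` and `Λ(gh) = Λ(g)Λ(h)` for
monic `g, h` (Schmidt's "`X(h₁h₂) = X(h₁)X(h₂)`", Ch. II §8, p. 63). [cite: Schmidt1976, Ch. II §8, p. 63] -/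
structure IsMonicMul (Λ : F[X] → ℂ) : Prop where
  map_one : Λ 1 = 1
  map_mul : ∀ {g h : F[X]}, g.Monic → h.Monic → Λ (g * h) = Λ g * Λ h

/-- `Λ(h^j) = Λ(h)^j` for monic `h`. [folklore] -/
theorem IsMonicMul.map_pow {Λ : F[X] → ℂ} (hΛ : IsMonicMul Λ) {h : F[X]} (hh : h.Monic) (j : ℕ) :
    Λ (h ^ j) = Λ h ^ j := by
  induction j with
  | zero => simp [hΛ.map_one]
  | succ j ih => rw [pow_succ, hΛ.map_mul (hh.pow j) hh, ih, pow_succ]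

variable [Fintype F] [DecidableEq F]

/-- `c_n = Σ_{h monic, deg h = n} Λ(h)`, the `n`-th coefficient of `L(U) = Σ_h Λ(h) U^{deg h}`.
[cite: Schmidt1976, Ch. II §8, (8.2) and §9, (9.6)] -/
def lsumOf (Λ : F[X] → ℂ) (n : ℕ) : ℂ :=
  ∑ h ∈ monics n, Λ h

/-- `c_0 = 1`. [folklore] -/
theorem lsumOf_zero {Λ : F[X] → ℂ} (hΛ : IsMonicMul Λ) : lsumOf Λ 0 = 1 := by
  unfold lsumOf
  rw [sum_monics]
  simp [KloostermanLFunction.ofCoeffs, hΛ.map_one]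

/-- `S_i = Σ_{P monic irreducible, j ≥ 1, j·deg P = i} deg P · Λ(P)^j`, the `i`-th coefficient of
`U L′(U)/L(U)` (logarithmic derivative of the Euler product, Theorem 8B).
[cite: Schmidt1976, Ch. II §8, Theorem 8B] -/
def psumOf (Λ : F[X] → ℂ) (i : ℕ) : ℂ :=
  ∑ Pj ∈ (irrMonicsLE i ×ˢ Finset.Icc 1 i).filter
      (fun Pj : F[X] × ℕ => Pj.2 * Pj.1.natDegree = i),
    (Pj.1.natDegree : ℂ) * Λ Pj.1 ^ Pj.2

open Classical in
/-- The multiples of `P^j` (`P` monic) among the monic polynomials of degree `n` are the `P^j g`,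
`g` monic of degree `n − j deg P`; hence `Σ_{deg h = n, P^j ∣ h} Λ(h) = Λ(P)^j c_{n − j deg P}`, and
`0` if `j deg P > n`. [folklore] -/
theorem sum_filter_dvd {Λ : F[X] → ℂ} (hΛ : IsMonicMul Λ) {n : ℕ} {P : F[X]} (hPm : P.Monic)
    (j : ℕ) :
    ∑ h ∈ (monics n).filter (fun h => P ^ j ∣ h), Λ h =
      if j * P.natDegree ≤ n then Λ P ^ j * lsumOf Λ (n - j * P.natDegree) else 0 := by
  classical
  set m := j * P.natDegree with hm
  have hdegPj : (P ^ j).natDegree = m := by rw [natDegree_pow]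
  split_ifs with hle
  · unfold lsumOf
    rw [Finset.mul_sum]
    symm
    refine Finset.sum_bij (fun g _ => P ^ j * g) ?_ ?_ ?_ ?_
    · intro g hg
      rw [mem_monics] at hg
      rw [Finset.mem_filter, mem_monics]
      refine ⟨⟨(hPm.pow j).mul hg.1, ?_⟩, dvd_mul_right _ _⟩
      rw [(hPm.pow j).natDegree_mul hg.1, hdegPj, hg.2]
      omega
    · intro g₁ _ g₂ _ heq
      exact mul_left_cancel₀ (pow_ne_zero j hPm.ne_zero) heq
    · intro h hh
      rw [Finset.mem_filter, mem_monics] at hh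
      obtain ⟨⟨hhm, hhd⟩, g, rfl⟩ := hh
      have hgm : g.Monic := Monic.of_mul_monic_left (hPm.pow j) hhm
      refine ⟨g, ?_, rfl⟩
      rw [mem_monics]
      refine ⟨hgm, ?_⟩
      have := (hPm.pow j).natDegree_mul hgm
      rw [hhd, hdegPj] at this
      omega
    · intro g hg
      rw [mem_monics] at hg
      rw [hΛ.map_mul (hPm.pow j) hg.1, hΛ.map_pow hPm]
  · apply Finset.sum_eq_zero
    intro h hh
    rw [Finset.mem_filter, mem_monics] at hh
    exfalso
    have := natDegree_le_of_dvd hh.2 hh.1.1.ne_zero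
    rw [hdegPj, hh.1.2] at this
    exact hle this

/-- **The von Mangoldt identity** (`U L′ = (U L′/L)·L` coefficientwise) for a completely
multiplicative `Λ` on monic polynomials: `n·c_n = Σ_{i=1}^{n} S_i c_{n−i}` (Schmidt II §8, the Euler
product of Theorem 8B in finite form). [cite: Schmidt1976, Ch. II §8, Theorem 8B] -/
theorem mul_lsumOf_eq_sum {Λ : F[X] → ℂ} (hΛ : IsMonicMul Λ) (n : ℕ) :
    (n : ℂ) * lsumOf Λ n = ∑ i ∈ Finset.Icc 1 n, psumOf Λ i * lsumOf Λ (n - i) := by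
  classical
  set PP : Finset (F[X] × ℕ) := irrMonicsLE n ×ˢ Finset.Icc 1 n with hPP
  -- Step 1: `n c_n = Σ_{(P,j)} deg P · Σ_{deg h = n, P^j ∣ h} Λ(h)`
  have step1 : (n : ℂ) * lsumOf Λ n =
      ∑ Pj ∈ PP, (Pj.1.natDegree : ℂ) *
        ∑ h ∈ (monics n).filter (fun h => Pj.1 ^ Pj.2 ∣ h), Λ h := by
    unfold lsumOf
    rw [Finset.mul_sum]
    have hh : ∀ h ∈ monics n, (n : ℂ) * Λ h =
        ∑ Pj ∈ PP, if Pj.1 ^ Pj.2 ∣ h then (Pj.1.natDegree : ℂ) * Λ h else 0 := by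
      intro h hh
      rw [mem_monics] at hh
      rw [← Finset.sum_filter, ← Finset.sum_mul]
      congr 1
      rw [hPP]
      exact_mod_cast (sum_primePowers_dvd_eq_natDegree hh.1 hh.2).symm
    rw [Finset.sum_congr rfl hh, Finset.sum_comm]
    refine Finset.sum_congr rfl fun Pj _ => ?_
    rw [Finset.mul_sum, Finset.sum_filter]
  -- Step 2: evaluate the inner sums and drop the pairs with `j deg P > n`
  have step2 : (n : ℂ) * lsumOf Λ n =
      ∑ Pj ∈ PP.filter (fun Pj : F[X] × ℕ => Pj.2 * Pj.1.natDegree ≤ n),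
        (Pj.1.natDegree : ℂ) * (Λ Pj.1 ^ Pj.2 * lsumOf Λ (n - Pj.2 * Pj.1.natDegree)) := by
    rw [step1, Finset.sum_filter]
    refine Finset.sum_congr rfl fun Pj hPj => ?_
    have hPm : Pj.1.Monic := by
      simp only [hPP, Finset.mem_product, mem_irrMonicsLE] at hPj
      exact hPj.1.1
    rw [sum_filter_dvd hΛ hPm Pj.2]
    split_ifs <;> simp
  -- Step 3: group the pairs by `i = j deg P ∈ [1, n]`
  rw [step2, ← Finset.sum_fiberwise_of_maps_to
    (s := PP.filter (fun Pj : F[X] × ℕ => Pj.2 * Pj.1.natDegree ≤ n)) (t := Finset.Icc 1 n)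
    (g := fun Pj : F[X] × ℕ => Pj.2 * Pj.1.natDegree) ?_]
  · refine Finset.sum_congr rfl fun i hi => ?_
    rw [Finset.mem_Icc] at hi
    unfold psumOf
    rw [Finset.sum_mul]
    have hset : (PP.filter (fun Pj : F[X] × ℕ => Pj.2 * Pj.1.natDegree ≤ n)).filter
          (fun Pj : F[X] × ℕ => Pj.2 * Pj.1.natDegree = i) =
        (irrMonicsLE i ×ˢ Finset.Icc 1 i).filter
          (fun Pj : F[X] × ℕ => Pj.2 * Pj.1.natDegree = i) := by
      ext ⟨P, j⟩
      simp only [hPP, Finset.mem_filter, Finset.mem_product, mem_irrMonicsLE, Finset.mem_Icc]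
      constructor
      · rintro ⟨⟨⟨⟨hPm, hPi, -⟩, hj1, -⟩, -⟩, heq⟩
        have hdeg := one_le_natDegree_of_irreducible hPi
        refine ⟨⟨⟨hPm, hPi, ?_⟩, hj1, ?_⟩, heq⟩ <;> nlinarith
      · rintro ⟨⟨⟨hPm, hPi, hPi'⟩, hj1, hji⟩, heq⟩
        refine ⟨⟨⟨⟨hPm, hPi, ?_⟩, hj1, ?_⟩, ?_⟩, heq⟩ <;> omega
    rw [hset]
    refine Finset.sum_congr rfl fun Pj hPj => ?_
    rw [Finset.mem_filter] at hPj
    rw [hPj.2]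
    ring
  · intro Pj hPj
    simp only [hPP, Finset.mem_filter, Finset.mem_product, mem_irrMonicsLE, Finset.mem_Icc] at hPj
    obtain ⟨⟨⟨-, hPi, -⟩, hj1, -⟩, hle⟩ := hPj
    rw [Finset.mem_Icc]
    have hdeg := one_le_natDegree_of_irreducible hPi
    exact ⟨by nlinarith, hle⟩

/-- `S_1 = c_1` (the case `n = 1` of the von Mangoldt identity, `c_0 = 1`). [folklore] -/
theorem psumOf_one {Λ : F[X] → ℂ} (hΛ : IsMonicMul Λ) : psumOf Λ 1 = lsumOf Λ 1 := by
  have I := mul_lsumOf_eq_sum hΛ 1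
  rw [Finset.Icc_self, Finset.sum_singleton, Nat.sub_self, lsumOf_zero hΛ, mul_one, Nat.cast_one,
    one_mul] at I
  exact I.symm

end Generic

/-! ### §2. The hybrid function `λ(h) = χ({f/h}) ψ([bX/h])` of a split polynomial `f` -/

section Lam

variable {F : Type*} [Field F]

/-- Schmidt's `X(h) = χ({f/h}) ψ([g/h])` for the split polynomial `f = c Π_{i<ℓ} (X − r_i)` and
`g = bX`, written without roots of `h`: for monic `h` of degree `k`,
`{f/h} = Π_{h(β)=0} f(β) = c^k (−1)^{ℓk} Π_i h(r_i)` and `[g/h] = b Σ_{h(β)=0} β = −b·nextCoeff h`.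
[cite: Schmidt1976, Ch. II §9, p. 64] -/
def lam (χ : MulChar F ℂ) (ψ : AddChar F ℂ) (c : F) {ℓ : ℕ} (r : Fin ℓ → F) (b : F)
    (h : F[X]) : ℂ :=
  χ (c ^ h.natDegree * (-1) ^ (ℓ * h.natDegree) * ∏ i, h.eval (r i)) * ψ (-(b * h.nextCoeff))

variable (χ : MulChar F ℂ) (ψ : AddChar F ℂ) (c : F) {ℓ : ℕ} (r : Fin ℓ → F) (b : F)

/-- `λ(1) = 1`. [folklore] -/
theorem lam_one : lam χ ψ c r b 1 = 1 := by
  unfold lam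
  have h1 : (1 : F[X]).nextCoeff = 0 := by rw [← C_1, nextCoeff_C_eq_zero]
  simp [h1]

/-- `λ(gh) = λ(g)λ(h)` for monic `g, h` (`{f/gh} = {f/g}{f/h}`, `[g/h₁h₂] = [g/h₁] + [g/h₂]`,
Schmidt II §9, Lemma 9A). [cite: Schmidt1976, Ch. II §9, Lemma 9A] -/
theorem lam_mul {g h : F[X]} (hg : g.Monic) (hh : h.Monic) :
    lam χ ψ c r b (g * h) = lam χ ψ c r b g * lam χ ψ c r b h := by
  unfold lam
  rw [hg.natDegree_mul hh, hg.nextCoeff_mul hh]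
  have hprod : ∏ i, (g * h).eval (r i) = (∏ i, g.eval (r i)) * ∏ i, h.eval (r i) := by
    rw [← Finset.prod_mul_distrib]
    exact Finset.prod_congr rfl fun i _ => eval_mul
  have harg : c ^ (g.natDegree + h.natDegree) * (-1) ^ (ℓ * (g.natDegree + h.natDegree)) *
        ((∏ i, g.eval (r i)) * ∏ i, h.eval (r i)) =
      (c ^ g.natDegree * (-1) ^ (ℓ * g.natDegree) * ∏ i, g.eval (r i)) *
        (c ^ h.natDegree * (-1) ^ (ℓ * h.natDegree) * ∏ i, h.eval (r i)) := by
    rw [pow_add, mul_add, pow_add]; ring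
  have hψ : ψ (-(b * (g.nextCoeff + h.nextCoeff))) =
      ψ (-(b * g.nextCoeff)) * ψ (-(b * h.nextCoeff)) := by
    rw [← AddChar.map_add_eq_mul]; congr 1; ring
  rw [hprod, harg, map_mul, hψ]
  ring

/-- `λ` is completely multiplicative on monic polynomials. [cite: Schmidt1976, Ch. II §9, Lemma 9A] -/
theorem isMonicMul_lam : IsMonicMul (lam χ ψ c r b) :=
  ⟨lam_one χ ψ c r b, fun hg hh => lam_mul χ ψ c r b hg hh⟩

/-- `λ(X − β) = χ(f(β)) ψ(bβ)` with `f(β) = c Π_i (β − r_i)`: the degree-one coefficient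
`c_1 = Σ_β λ(X − β)` is the hybrid sum `Σ_{x ∈ F} χ(f(x)) ψ(bx)`. [cite: Schmidt1976, Ch. II §9, (9.6)] -/
theorem lam_X_sub_C (β : F) :
    lam χ ψ c r b (X - C β) = χ (c * ∏ i, (β - r i)) * ψ (b * β) := by
  unfold lam
  have hn : (X - C β).nextCoeff = -β := by
    rw [sub_eq_add_neg, ← C_neg, nextCoeff_X_add_C]
  have hprod : ∏ i, (β - r i) = (-1) ^ ℓ * ∏ i, (X - C β).eval (r i) := by
    have key : ∀ s : Finset (Fin ℓ),
        ∏ i ∈ s, (β - r i) = (-1) ^ s.card * ∏ i ∈ s, (X - C β).eval (r i) := by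
      intro s
      induction s using Finset.induction_on with
      | empty => simp
      | insert a s ha ih =>
        rw [Finset.prod_insert ha, Finset.prod_insert ha, ih, Finset.card_insert_of_notMem ha,
          pow_succ]
        simp only [eval_sub, eval_X, eval_C]
        ring
    rw [key, Finset.card_univ, Fintype.card_fin]
  rw [natDegree_X_sub_C, hn, hprod]
  congr 2 <;> ring

variable [Fintype F] [DecidableEq F]

/-- **`c_1` is the hybrid sum**: `lsumOf λ 1 = Σ_{x ∈ F} χ(c Π_i (x − r_i)) ψ(bx)`.
[cite: Schmidt1976, Ch. II §9, (9.6)] -/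
theorem lsumOf_lam_one :
    lsumOf (lam χ ψ c r b) 1 = ∑ x : F, χ (c * ∏ i, (x - r i)) * ψ (b * x) := by
  unfold lsumOf
  rw [sum_monics, Fintype.sum_equiv (Equiv.funUnique (Fin 1) F) _
    (fun a : F => χ (c * ∏ i, (-a - r i)) * ψ (b * -a))]
  · rw [← Equiv.sum_comp (Equiv.neg F)]
    refine Fintype.sum_congr _ _ fun x => ?_
    simp only [Equiv.neg_apply, neg_neg]
  · intro v
    have : KloostermanLFunction.ofCoeffs 1 v = X - C (-v 0) := by
      simp [KloostermanLFunction.ofCoeffs, sub_eq_add_neg]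
    rw [this, lam_X_sub_C]
    rfl

end Lam

/-! ### §3. `c_n = 0` for `n > ℓ`: the `L`-function is a polynomial of degree `≤ ℓ` -/

section Vanishing

variable {F : Type*} [Field F]

/-- The polynomial `Σ_{i<ℓ} w_i X^i` of degree `< ℓ` with coefficient vector `w`. [folklore] -/
def lowPoly {ℓ : ℕ} (w : Fin ℓ → F) : F[X] :=
  ∑ i : Fin ℓ, C (w i) * X ^ (i : ℕ)

/-- `deg (lowPoly w) < ℓ`. [folklore] -/
theorem degree_lowPoly_lt {ℓ : ℕ} (w : Fin ℓ → F) : (lowPoly w).degree < ℓ :=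
  degree_sum_fin_lt w

/-- Coefficients of `lowPoly w`. [folklore] -/
theorem coeff_lowPoly {ℓ : ℕ} (w : Fin ℓ → F) (j : ℕ) :
    (lowPoly w).coeff j = if hj : j < ℓ then w ⟨j, hj⟩ else 0 := by
  unfold lowPoly
  rw [finsetSum_coeff]
  split_ifs with hj
  · rw [Finset.sum_eq_single (⟨j, hj⟩ : Fin ℓ)]
    · simp
    · intro i _ hi
      rw [coeff_C_mul, coeff_X_pow, if_neg, mul_zero]
      intro h
      exact hi (Fin.ext h.symm)
    · intro h
      exact (h (Finset.mem_univ _)).elim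
  · apply Finset.sum_eq_zero
    intro i _
    rw [coeff_C_mul, coeff_X_pow, if_neg, mul_zero]
    intro h
    exact hj (h ▸ i.is_lt)

/-- A polynomial of degree `< ℓ` is `lowPoly` of its coefficient vector. [folklore] -/
theorem eq_lowPoly_of_degree_lt {ℓ : ℕ} {ρ : F[X]} (hρ : ρ.degree < ℓ) :
    ρ = lowPoly fun i : Fin ℓ => ρ.coeff i := by
  ext j
  rw [coeff_lowPoly]
  split_ifs with hj
  · rfl
  · apply coeff_eq_zero_of_degree_lt
    exact hρ.trans_le (by exact_mod_cast not_lt.mp hj)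

/-- `lowPoly` is injective. [folklore] -/
theorem lowPoly_injective (ℓ : ℕ) : Function.Injective (lowPoly (F := F) (ℓ := ℓ)) := by
  intro v w h
  funext i
  simpa [coeff_lowPoly] using congrArg (fun p : F[X] => p.coeff i) h

variable {ℓ : ℕ} (r : Fin ℓ → F)

/-- The node polynomial `V = Π_i (X − r_i)` (Mathlib's `Lagrange.nodal`), monic of degree `ℓ`,
vanishing at the `r_i`. [folklore] -/
abbrev nodePoly : F[X] := Lagrange.nodal Finset.univ r

/-- Writing a monic `h` of degree `m + ℓ` as `Q·V + ρ` (`Q` monic of degree `m`, `deg ρ < ℓ`):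
the map `(Q, w) ↦ Q·V + lowPoly w` is injective. [folklore] -/
theorem mul_nodePoly_add_lowPoly_injective {Q Q' : F[X]} {w w' : Fin ℓ → F}
    (h : Q * nodePoly r + lowPoly w = Q' * nodePoly r + lowPoly w') : Q = Q' ∧ w = w' := by
  have hV : (nodePoly r).Monic := Lagrange.nodal_monic
  have hdeg : ∀ v : Fin ℓ → F, (lowPoly v).degree < (nodePoly r).degree := fun v => by
    rw [Lagrange.degree_nodal, Finset.card_univ, Fintype.card_fin]; exact degree_lowPoly_lt v
  have hu := div_modByMonic_unique (f := Q * nodePoly r + lowPoly w) Q (lowPoly w) hV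
    ⟨by ring, hdeg w⟩
  have hu' := div_modByMonic_unique (f := Q * nodePoly r + lowPoly w) Q' (lowPoly w') hV
    ⟨by rw [h]; ring, hdeg w'⟩
  exact ⟨hu.1.symm.trans hu'.1, lowPoly_injective ℓ (hu.2.symm.trans hu'.2)⟩

variable [Fintype F] [DecidableEq F]

/-- **Division by `V`**: the monic polynomials of degree `m + ℓ` are exactly the `Q·V + lowPoly w`
with `Q` monic of degree `m` and `w ∈ F^ℓ`. [folklore] -/
theorem monics_add_eq_image (m : ℕ) :
    monics (m + ℓ) = ((monics m) ×ˢ (Finset.univ : Finset (Fin ℓ → F))).image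
      (fun p => p.1 * nodePoly r + lowPoly p.2) := by
  have hV : (nodePoly r).Monic := Lagrange.nodal_monic
  have hVdeg : (nodePoly r).natDegree = ℓ := by
    rw [Lagrange.natDegree_nodal, Finset.card_univ, Fintype.card_fin]
  have hVdeg' : (nodePoly r).degree = ℓ := by
    rw [Lagrange.degree_nodal, Finset.card_univ, Fintype.card_fin]
  ext h
  rw [Finset.mem_image, mem_monics]
  constructor
  · rintro ⟨hhm, hhd⟩
    refine ⟨(h /ₘ nodePoly r, fun i => (h %ₘ nodePoly r).coeff i), ?_, ?_⟩
    · rw [Finset.mem_product, mem_monics]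
      refine ⟨⟨?_, ?_⟩, Finset.mem_univ _⟩
      · have hle : (nodePoly r).degree ≤ h.degree := by
          rw [hVdeg', degree_eq_natDegree hhm.ne_zero, hhd]; exact_mod_cast Nat.le_add_left ℓ m
        rw [Monic, leadingCoeff_divByMonic_of_monic hV hle]; exact hhm
      · rw [natDegree_divByMonic h hV, hhd, hVdeg, Nat.add_sub_cancel]
    · dsimp only
      rw [← eq_lowPoly_of_degree_lt (hVdeg' ▸ degree_modByMonic_lt h hV), mul_comm,
        add_comm, modByMonic_add_div]
  · rintro ⟨⟨Q, w⟩, hQw, rfl⟩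
    rw [Finset.mem_product, mem_monics] at hQw
    obtain ⟨⟨hQm, hQd⟩, -⟩ := hQw
    have hQV : (Q * nodePoly r).Monic := hQm.mul hV
    have hQVd : (Q * nodePoly r).natDegree = m + ℓ := by rw [hQm.natDegree_mul hV, hQd, hVdeg]
    have hlt : (lowPoly w).degree < (Q * nodePoly r).degree := by
      rw [degree_eq_natDegree hQV.ne_zero, hQVd]
      exact (degree_lowPoly_lt w).trans_le (by exact_mod_cast Nat.le_add_left ℓ m)
    exact ⟨hQV.add_of_left hlt, by rw [natDegree_add_eq_left_of_degree_lt hlt, hQVd]⟩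

/-- Sums over monic polynomials of degree `m + ℓ` as double sums over `(Q, w)`. [folklore] -/
theorem sum_monics_add {M : Type*} [AddCommMonoid M] (m : ℕ) (g : F[X] → M) :
    ∑ h ∈ monics (m + ℓ), g h =
      ∑ Q ∈ monics m, ∑ w : Fin ℓ → F, g (Q * nodePoly r + lowPoly w) := by
  rw [monics_add_eq_image r m, Finset.sum_image, Finset.sum_product]
  rintro ⟨Q, w⟩ - ⟨Q', w'⟩ - h
  obtain ⟨h1, h2⟩ := mul_nodePoly_add_lowPoly_injective r h
  exact Prod.ext h1 h2

/-- **Evaluation at distinct nodes is a bijection** `{deg < ℓ} → F^ℓ` (Lagrange interpolation):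
`w ↦ (lowPoly w (r_i))_i` is bijective when the `r_i` are distinct. [folklore] -/
theorem bijective_eval_lowPoly (hr : Function.Injective r) :
    Function.Bijective fun w : Fin ℓ → F => fun i => (lowPoly w).eval (r i) := by
  rw [← Finite.injective_iff_bijective]
  intro w w' h
  have hsub : lowPoly w - lowPoly w' = lowPoly (w - w') := by
    unfold lowPoly
    rw [← Finset.sum_sub_distrib]
    exact Finset.sum_congr rfl fun i _ => by simp [sub_mul]
  have hroots : ∀ i, (lowPoly (w - w')).eval (r i) = 0 := fun i => by
    have := congrFun h i
    dsimp only at this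
    rw [← hsub, eval_sub, this, sub_self]
  have hzero : lowPoly (w - w') = 0 := by
    by_contra h0
    refine h0 (eq_zero_of_natDegree_lt_card_of_eval_eq_zero _ hr hroots ?_)
    rw [Fintype.card_fin]
    exact (natDegree_lt_iff_degree_lt h0).mpr (degree_lowPoly_lt _)
  have h0' : lowPoly (w - w') = lowPoly (0 : Fin ℓ → F) := by
    rw [hzero]; unfold lowPoly; simp
  exact sub_eq_zero.mp (lowPoly_injective ℓ h0')

variable (χ : MulChar F ℂ) (ψ : AddChar F ℂ) (c : F) (b : F)

omit [Fintype F] [DecidableEq F] in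
/-- `λ(QV + ρ) = χ(c^n (−1)^{ℓn} Π_i ρ(r_i)) ψ(−b(nextCoeff Q + nextCoeff V))` for `Q` monic of
degree `m ≥ 1`, `deg ρ < ℓ`, `n = m + ℓ` (`V(r_i) = 0`; the top coefficients of `QV + ρ` are those
of `QV`). [cite: Schmidt1976, Ch. II §9, proof of Lemma 9B] -/
theorem lam_mul_nodePoly_add {m : ℕ} (hm : 1 ≤ m) {Q : F[X]} (hQm : Q.Monic)
    (hQd : Q.natDegree = m) (w : Fin ℓ → F) :
    lam χ ψ c r b (Q * nodePoly r + lowPoly w) =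
      χ (c ^ (m + ℓ) * (-1) ^ (ℓ * (m + ℓ)) * ∏ i, (lowPoly w).eval (r i)) *
        ψ (-(b * (Q.nextCoeff + (nodePoly r).nextCoeff))) := by
  have hV : (nodePoly r).Monic := Lagrange.nodal_monic
  have hVdeg : (nodePoly r).natDegree = ℓ := by
    rw [Lagrange.natDegree_nodal, Finset.card_univ, Fintype.card_fin]
  have hQV : (Q * nodePoly r).Monic := hQm.mul hV
  have hQVd : (Q * nodePoly r).natDegree = m + ℓ := by rw [hQm.natDegree_mul hV, hQd, hVdeg]
  have hlt : (lowPoly w).degree < (Q * nodePoly r).degree := by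
    rw [degree_eq_natDegree hQV.ne_zero, hQVd]
    exact (degree_lowPoly_lt w).trans_le (by exact_mod_cast Nat.le_add_left ℓ m)
  have hnd : (Q * nodePoly r + lowPoly w).natDegree = m + ℓ := by
    rw [natDegree_add_eq_left_of_degree_lt hlt, hQVd]
  have heval : ∀ i, (Q * nodePoly r + lowPoly w).eval (r i) = (lowPoly w).eval (r i) := by
    intro i
    rw [eval_add, eval_mul, Lagrange.eval_nodal_at_node (Finset.mem_univ i), mul_zero, zero_add]
  have hnext : (Q * nodePoly r + lowPoly w).nextCoeff = Q.nextCoeff + (nodePoly r).nextCoeff := by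
    rw [← hQm.nextCoeff_mul hV, nextCoeff_of_natDegree_pos (p := Q * nodePoly r + lowPoly w)
        (by rw [hnd]; omega), nextCoeff_of_natDegree_pos (p := Q * nodePoly r) (by rw [hQVd]; omega),
      hnd, hQVd, coeff_add]
    have : (lowPoly w).coeff (m + ℓ - 1) = 0 := by
      apply coeff_eq_zero_of_degree_lt
      exact (degree_lowPoly_lt w).trans_le (by exact_mod_cast (show ℓ ≤ m + ℓ - 1 by omega))
    rw [this, add_zero]
  unfold lam
  rw [hnd, hnext, Finset.prod_congr rfl fun i _ => heval i]

/-- The character-sum factor vanishes: `Σ_{w ∈ F^ℓ} Π_i χ(lowPoly w (r_i)) = (Σ_{v ∈ F} χ(v))^ℓ = 0`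
for `χ ≠ 1`, `ℓ ≥ 1` and distinct nodes. [cite: Schmidt1976, Ch. II §9, proof of Lemma 9B] -/
theorem sum_prod_chi_eval_lowPoly_eq_zero (hχ : χ ≠ 1) (hr : Function.Injective r) (hℓ : 1 ≤ ℓ) :
    ∑ w : Fin ℓ → F, ∏ i, χ ((lowPoly w).eval (r i)) = 0 := by
  rw [(bijective_eval_lowPoly r hr).sum_comp (fun v : Fin ℓ → F => ∏ i, χ (v i))]
  have h := Finset.prod_univ_sum (fun _ : Fin ℓ => (Finset.univ : Finset F)) (fun _ x => χ x)
  rw [Fintype.piFinset_univ] at h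
  rw [← h, Finset.prod_const, MulChar.sum_eq_zero_of_ne_one hχ, Finset.card_univ, Fintype.card_fin,
    zero_pow (by omega)]

/-- **Schmidt II §9 (Lemma 9B-type vanishing) for split `f` — PROVED**: if `χ ≠ 1`, `ℓ ≥ 1` and the
roots `r_i` are distinct, then `c_n = Σ_{deg h = n} λ(h) = 0` for all `n ≥ ℓ + 1`; thus
`L(U) = Σ_h χ({f/h}) ψ([bX/h]) U^{deg h} = 1 + c_1 U + ⋯ + c_ℓ U^ℓ` is a polynomial of degree `≤ ℓ`.
[cite: Schmidt1976, Ch. II §9, Lemmas 9B–9C] -/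
theorem lsumOf_lam_eq_zero (hχ : χ ≠ 1) (hr : Function.Injective r) (hℓ : 1 ≤ ℓ) {n : ℕ}
    (hn : ℓ + 1 ≤ n) : lsumOf (lam χ ψ c r b) n = 0 := by
  obtain ⟨m, rfl⟩ : ∃ m, n = m + ℓ := ⟨n - ℓ, by omega⟩
  have hm : 1 ≤ m := by omega
  unfold lsumOf
  rw [sum_monics_add r m]
  apply Finset.sum_eq_zero
  intro Q hQ
  rw [mem_monics] at hQ
  have hfac : ∀ w : Fin ℓ → F, lam χ ψ c r b (Q * nodePoly r + lowPoly w) =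
      (χ (c ^ (m + ℓ) * (-1) ^ (ℓ * (m + ℓ))) * ψ (-(b * (Q.nextCoeff + (nodePoly r).nextCoeff)))) *
        ∏ i, χ ((lowPoly w).eval (r i)) := by
    intro w
    rw [lam_mul_nodePoly_add r χ ψ c b hm hQ.1 hQ.2 w, map_mul, map_prod]
    ring
  rw [Finset.sum_congr rfl fun w _ => hfac w, ← Finset.mul_sum,
    sum_prod_chi_eval_lowPoly_eq_zero r χ hχ hr hℓ, mul_zero]

end Vanishing

end HybridLFunction

end Literature.NumberTheory.LFunctions
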